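import Summits.QuantumFields.BalabanUV.Beta.D1BFx.TwoBondWardPairing
import Literature.MathematicalPhysics.QuantumFieldTheory.Balaban1983to89.Beta.ExpKernelCalculus

/-!
# `BalabanUV.Beta.D1BFx.TwoBondWardPairingJoint` — road «BF-x» for binder row D1, slot (K), junction (J3), brick (B2) second half, GENERIC CORE 2:
# **THE ITERATED TWO-BOND PAIRING EQUALS THE JOINT PAIR-SUM** (`Σ_κ Σ'_u w₁(κ,u)·Σ_l Σ'_{u′} w₂(l,u′)·H = Σ_κ Σ_l Σ'_{(u,u′)} w₁(κ,u)·w₂(l,u′)·H`)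
# for a bounded first weight, an exponentially decaying second weight and a table decaying off the diagonal — the `Σ' q : Site × Site`
# currency of `DressedBubbleBridge.bubble_wsum_wsum` ∕ `DressedTadpoleTable.tadpole_wsum_wsum` (the superposition identities the road's
# `hessKer` words are expanded with), so that `TwoBondWardPairing.pairing_grad_shift_invariant` can be consumed in either currency.

HONEST DEPENDENCY (cell records, verbatim): «continuum YM on T⁴ ⇐ BetaPertH ∧ nine spine estimates (0/9 proved); BetaPertH ⇐ (D1) ∧ (D4) ∧
CAP+tail; G-an2-4 gates asym, D1 and NE2/3/4.»  HONEST FRAMING (cell contract, verbatim): «discharging `BetaPertH` makes Bałaban's UV stability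
UNCONDITIONAL — a real constructive-QFT result; it is NOT the continuum limit and NOT the Clay problem.»  THIS MODULE DISCHARGES NOTHING of the
wall: [folklore] `tsum` Fubini bookkeeping (`summable_prod_of_nonneg`, `Summable.tsum_prod'`) at dimension 4; every analytic condition is a
HYPOTHESIS; no object of Bałaban's appears.  No definition, no `def … : Prop`, no notation, nothing cited, 0 sorry.  0 root-level binders of row D1
discharged (hW ∕ hR-sockets ∕ hSX-socket ∕ D1Tel ∕ D1Rep — 0); (J3) remains DISPLAYED; (K) NOT closed; NOT D1, NOT `BetaPertH`, NOT continuum, NOT Clay.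

ABSOLUTE RULE (cell charter, verbatim): «No internally-minted statement may enter as a cited fact. Every hypothesis is either kernel-proved in
this package or a verbatim quotation of a PUBLISHED theorem with page reference. The manuscript(s) under audit are NOT citable for their own
disputed steps — they are the thing under adjudication; programme-internal (2001/route/tribunal) claims are never citable.»

Unit `b2b-balaban-beta-d1-formalise-leaf-04` (gen 21), D1 formalisation swarm leaf prover 04, road «BF-x»; (B2) second half per R-D1-g40-1 ∕ ρ-g19-4 (journal).
-/

noncomputable section

open Finset
open scoped BigOperators
open Literature.MathematicalPhysics.QuantumFieldTheory
open Literature.MathematicalPhysics.QuantumFieldTheory.Balaban1983to89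
open Literature.MathematicalPhysics.QuantumFieldTheory.Balaban1983to89.Beta
open B12Sec2to5 (l1 l1_nonneg)
open ExpKernelCalculus (Site Zl Zl_pos summable_exp_shift summable_exp_shift' tsum_exp_shift tsum_exp_shift' l1_sub_triangle l1_sub_symm)
open AffineAveraging (Form1)
open Summit.QuantumFields.BalabanUV.Beta.D1BFx.TwoBondWardPairing (summable_bdd_mul)

namespace Summit.QuantumFields.BalabanUV.Beta.D1BFx.TwoBondWardPairingJoint

/-- [folklore] **JOINT SUMMABILITY OF ONE `(κ, l)` SLICE**: for `|w₁| ≤ B₁`, `|w₂ u′| ≤ C₂·e^{−δ₂|u′−p|₁}`, `|H u u′| ≤ C·e^{−δ|u−u′|₁}`,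
the family `(u, u′) ↦ w₁ u·w₂ u′·H u u′` is summable on `Site 4 × Site 4`. -/
theorem summable_prod_slice {w₁ w₂ : Site 4 → ℝ} {H : Site 4 → Site 4 → ℝ} {B₁ C₂ δ₂ C δ : ℝ} {p : Site 4}
    (hw₁ : ∀ u, |w₁ u| ≤ B₁) (hw₂ : ∀ u', |w₂ u'| ≤ C₂ * Real.exp (-δ₂ * l1 (u' - p))) (hδ₂ : 0 < δ₂)
    (hH : ∀ u u', |H u u'| ≤ C * Real.exp (-δ * l1 (u - u'))) (hδ : 0 < δ) :
    Summable fun q : Site 4 × Site 4 => w₁ q.1 * w₂ q.2 * H q.1 q.2 := by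
  have hB₁ : 0 ≤ B₁ := (abs_nonneg _).trans (hw₁ 0)
  have hC₂ : 0 ≤ C₂ := by
    have h := (abs_nonneg _).trans (hw₂ p)
    rw [sub_self, show l1 (0 : Site 4) = 0 by simp [l1], mul_zero, Real.exp_zero, mul_one] at h
    exact h
  have hC : 0 ≤ C := by
    have h := (abs_nonneg _).trans (hH 0 0)
    rw [sub_self, show l1 (0 : Site 4) = 0 by simp [l1], mul_zero, Real.exp_zero, mul_one] at h
    exact h
  -- the majorant `M (u, u′) := B₁·C₂·C·e^{−δ₂|u′−p|}·e^{−δ|u−u′|}` is summable on the product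
  set M : Site 4 × Site 4 → ℝ := fun q => B₁ * C₂ * C * (Real.exp (-δ₂ * l1 (q.2 - p)) * Real.exp (-δ * l1 (q.1 - q.2))) with hM
  have hM0 : ∀ q, 0 ≤ M q := fun q => by positivity
  have hMs : Summable M := by
    rw [hM]
    refine Summable.mul_left _ ?_
    -- `(u, u′) ↦ e^{−δ₂|u′−p|}·e^{−δ|u−u′|}`: fibrewise in `u′`, then the `u′`-sum of the fibre sums `Zl δ·e^{−δ₂|u′−p|}`
    have h1 : ∀ u' : Site 4, Summable fun u : Site 4 => Real.exp (-δ₂ * l1 (u' - p)) * Real.exp (-δ * l1 (u - u')) :=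
      fun u' => (summable_exp_shift' hδ u').mul_left _
    have h2 : Summable fun u' : Site 4 => ∑' u : Site 4, Real.exp (-δ₂ * l1 (u' - p)) * Real.exp (-δ * l1 (u - u')) := by
      simp_rw [tsum_mul_left, tsum_exp_shift']
      exact (summable_exp_shift' hδ₂ p).mul_right _
    have h3 : Summable fun q : Site 4 × Site 4 => Real.exp (-δ₂ * l1 (q.1 - p)) * Real.exp (-δ * l1 (q.2 - q.1)) :=
      (summable_prod_of_nonneg (fun q => by positivity)).2 ⟨h1, h2⟩
    exact (Equiv.prodComm (Site 4) (Site 4)).summable_iff.mpr h3 |>.congr fun q => by simp [Equiv.prodComm]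
  refine Summable.of_norm_bounded hMs fun q => ?_
  rw [Real.norm_eq_abs, abs_mul, abs_mul, hM]
  calc |w₁ q.1| * |w₂ q.2| * |H q.1 q.2|
      ≤ B₁ * (C₂ * Real.exp (-δ₂ * l1 (q.2 - p))) * (C * Real.exp (-δ * l1 (q.1 - q.2))) :=
        mul_le_mul (mul_le_mul (hw₁ q.1) (hw₂ q.2) (abs_nonneg _) hB₁) (hH q.1 q.2) (abs_nonneg _) (by positivity)
    _ = B₁ * C₂ * C * (Real.exp (-δ₂ * l1 (q.2 - p)) * Real.exp (-δ * l1 (q.1 - q.2))) := by ring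

/-- [folklore] **ITERATED = JOINT**: under the hypotheses of `summable_prod_slice` for every `(κ, l)`,
`Σ_κ Σ'_u w₁(κ,u)·Σ_l Σ'_{u′} w₂(l,u′)·H κ l u u′ = Σ_κ Σ_l Σ'_{q} w₁(κ,q.1)·w₂(l,q.2)·H κ l q.1 q.2`. -/
theorem iterated_eq_joint {w₁ w₂ : Form1 4 ℝ} {H : Fin 4 → Fin 4 → Site 4 → Site 4 → ℝ} {B₁ C₂ δ₂ C δ : ℝ} {p : Site 4}
    (hw₁ : ∀ κ u, |w₁ κ u| ≤ B₁) (hw₂ : ∀ l u', |w₂ l u'| ≤ C₂ * Real.exp (-δ₂ * l1 (u' - p))) (hδ₂ : 0 < δ₂)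
    (hH : ∀ κ l u u', |H κ l u u'| ≤ C * Real.exp (-δ * l1 (u - u'))) (hδ : 0 < δ) :
    ∑ κ : Fin 4, ∑' u : Site 4, w₁ κ u * ∑ l : Fin 4, ∑' u' : Site 4, w₂ l u' * H κ l u u'
      = ∑ κ : Fin 4, ∑ l : Fin 4, ∑' q : Site 4 × Site 4, w₁ κ q.1 * w₂ l q.2 * H κ l q.1 q.2 := by
  refine Finset.sum_congr rfl fun κ _ => ?_
  have hs : ∀ l, Summable fun q : Site 4 × Site 4 => w₁ κ q.1 * w₂ l q.2 * H κ l q.1 q.2 :=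
    fun l => summable_prod_slice (hw₁ κ) (hw₂ l) hδ₂ (hH κ l) hδ
  -- each `(κ, l)` slice: joint = iterated (`Summable.tsum_prod'`), the inner row sums are summable
  have hrow : ∀ l u, Summable fun u' : Site 4 => w₁ κ u * w₂ l u' * H κ l u u' := fun l u =>
    (hs l).prod_factor u
  have hjoint : ∀ l, ∑' q : Site 4 × Site 4, w₁ κ q.1 * w₂ l q.2 * H κ l q.1 q.2
      = ∑' u : Site 4, ∑' u' : Site 4, w₁ κ u * w₂ l u' * H κ l u u' := fun l => (hs l).tsum_prod' (hrow l)
  have houter : ∀ l, Summable fun u : Site 4 => ∑' u' : Site 4, w₁ κ u * w₂ l u' * H κ l u u' := fun l => (hs l).prod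
  simp_rw [hjoint]
  rw [← Summable.tsum_finsetSum (fun l _ => houter l)]
  refine tsum_congr fun u => ?_
  rw [Finset.mul_sum]
  refine Finset.sum_congr rfl fun l _ => ?_
  rw [← tsum_mul_left]
  exact tsum_congr fun u' => by ring

end Summit.QuantumFields.BalabanUV.Beta.D1BFx.TwoBondWardPairingJoint

end
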